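import Literature.NumberTheory.EllipticCurves.SqrtTwoTwistEntireLFunction
import Literature.NumberTheory.EllipticCurves.ComplexMultiplicationShaKnappProofs
import Literature.NumberTheory.EllipticCurves.ComplexMultiplicationTwistIsogenyProofs
import Literature.NumberTheory.EllipticCurves.ComplexMultiplicationShaHeckeProofs
import HarnessLib

/-!
# Entire continuation of `L(E, s)` for every elliptic curve over `ℚ` with `j = 8000`

Every elliptic curve `W / ℚ` with `j(W) = 8000` is `ℚ`-isomorphic to a quadratic twist
`B_n : y² = x³ + 4 n x² + 2 n² x` of `B₁ = [0, 4, 0, 2, 0]` (Cremona `256d1`, CM by `ℤ[√-2]`)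
by a square-free integer `n` (Silverman, *AEC* X.5 Prop. 5.4, Cor. 5.4.1, in the tree as
`exists_variableChange_eq_quadraticTwist_intCast_of_j_eq`), and `L(E, s)` is an isomorphism
invariant (`hasEntireLFunction_smul_iff`).  Hence the `ℤ[√-2]` theta dictionary of
`SqrtTwoTwistThetaDictionary` / `SqrtTwoTwistEntireLFunction` — `L(B_n, s)` is entire for every
square-free `n`, conditional only on Brewer's character-sum evaluation
`Brewer1961_characterSum` — gives the `j = 8000` row of the Deuring–Hecke continuation
`hasEntireLFunction_of_j_mem_maximalCMJInvariants` from that single printed identity.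

## Main statements

* `quadraticTwist_B_one` : `B₁^{(d)} = [0, 4d, 0, 2d², 0]` on the nose.
* `hasEntireLFunction_of_j_eq_8000_of_forall_squarefree` : the unconditional reduction of the
  class statement (`j(W) = 8000 ⇒ L(W, s)` entire) to the square-free family `B_n`.
* `hasEntireLFunction_of_j_eq_8000` : `j(W) = 8000 ⇒ L(W, s)` entire, conditional on
  `Brewer1961_characterSum` (Brewer 1961; Leonard–Williams 1975, Theorem p. 301).
-/

namespace Literature.NumberTheory.EllipticCurves.SqrtTwoTwist

open _root_.WeierstrassCurve

/-- The quadratic twist of `B₁ = [0, 4, 0, 2, 0]` by `d` in the tree's completed-square model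
(`WeierstrassCurve.quadraticTwist`: `[0, d b₂/4, 0, d² b₄/2, d³ b₆/4]`, here `b₂ = 16`, `b₄ = 4`,
`b₆ = 0`) is `B_d = [0, 4d, 0, 2d², 0]` on the nose. Silverman, *AEC* X.5 Cor. 5.4(iii). (The same
identity is recorded Summits-side as `…SqrtTwoCorner.quadraticTwist_B_one`; it is restated here
because `Literature` cannot import `Summits`.)
[cite: SilvermanAEC2009, X.5 Cor. 5.4] -/
theorem quadraticTwist_B_one (d : ℚ) :
    (⟨0, 4, 0, 2, 0⟩ : WeierstrassCurve ℚ).quadraticTwist d = ⟨0, 4 * d, 0, 2 * d ^ 2, 0⟩ := by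
  ext
  · rfl
  · simp only [quadraticTwist_a₂, b₂]
    ring
  · rfl
  · simp only [quadraticTwist_a₄, b₄]
    ring
  · simp only [quadraticTwist_a₆, b₆]
    ring

/-- **Reduction of the class statement to the square-free family.** If `L(B_n, s)` has an entire
continuation for every square-free integer `n`, where `B_n = [0, 4n, 0, 2n², 0]`, then so does
`L(W, s)` for every elliptic curve `W / ℚ` with `j(W) = 8000`: by Silverman, *AEC* X.5
Prop. 5.4 / Cor. 5.4.1 (`exists_variableChange_eq_quadraticTwist_intCast_of_j_eq`, applied with
`E = B₁ = cm8`, `j(B₁) = 8000 ≠ 0, 1728`) there are a square-free `n` and a change of variables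
`C` over `ℚ` with `C • W = B₁^{(n)} = B_n` (`quadraticTwist_B_one`), and the existence of an
entire continuation is an isomorphism invariant (`hasEntireLFunction_smul_iff`, Silverman,
*AEC* App. C §16). Unconditional.
[cite: SilvermanAEC2009, X.5 Prop. 5.4 and Cor. 5.4.1; App. C §16] -/
theorem hasEntireLFunction_of_j_eq_8000_of_forall_squarefree
    (hfam : ∀ n : ℤ, Squarefree n →
      (⟨0, 4 * (n : ℚ), 0, 2 * (n : ℚ) ^ 2, 0⟩ : WeierstrassCurve ℚ).HasEntireLFunction)
    (W : WeierstrassCurve ℚ) [W.IsElliptic] (hj : W.j = 8000) : W.HasEntireLFunction := by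
  have hjE : W.j = cm8.j := by rw [hj, j_cm8]
  have h0 : cm8.j ≠ 0 := by rw [j_cm8]; norm_num
  have h1728 : cm8.j ≠ 1728 := by rw [j_cm8]; norm_num
  obtain ⟨n, -, hsq, C, hC⟩ := exists_variableChange_eq_quadraticTwist_intCast_of_j_eq hjE h0 h1728
  rw [← hasEntireLFunction_smul_iff W C, hC]
  have hB : cm8.quadraticTwist (n : ℚ) = ⟨0, 4 * (n : ℚ), 0, 2 * (n : ℚ) ^ 2, 0⟩ :=
    quadraticTwist_B_one (n : ℚ)
  rw [hB]
  exact hfam n hsq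

/-- **`L(E, s)` is entire for every elliptic curve `E / ℚ` with `j(E) = 8000`, conditional on
Brewer's character sum.** Combine the reduction
`hasEntireLFunction_of_j_eq_8000_of_forall_squarefree` with the `ℤ[√-2]` theta dictionary
`hasEntireLFunction_of_brewer_of_squarefree` (`L(B_n, s)` = the Hecke theta `L`-series of weight
`2` attached to the Grössencharacter `ψ(α) = (-n / Nα) χ_H(α) α` of `ℚ(√-2)`, entire by the
binary theta functional equation), whose only unproved input is Brewer's evaluation
`Σ_x ((x+2)(x²-2) / p) = 2c` for `p = c² + 2d² ≡ 1, 3 (mod 8)` (`Brewer1961_characterSum`;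
its `p ≡ 1 (mod 8)` half is proved in `SqrtTwoTwistBrewerOneModEight`). This is the `j = 8000`
row of the Deuring–Hecke continuation `hasEntireLFunction_of_j_mem_maximalCMJInvariants`
(Deuring 1953–57; Silverman, *Advanced Topics* II.10.5).
[cite: SilvermanAdvancedTopics1994, II.10 Thm. 10.5 with Cor. 10.4.1; Brewer1961, Theorem 2] -/
theorem hasEntireLFunction_of_j_eq_8000 (hB : Brewer1961_characterSum)
    (W : WeierstrassCurve ℚ) [W.IsElliptic] (hj : W.j = 8000) : W.HasEntireLFunction :=
  hasEntireLFunction_of_j_eq_8000_of_forall_squarefree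
    (fun _ hn ↦ hasEntireLFunction_of_brewer_of_squarefree hB hn) W hj

/-- The membership `8000 ∈ maximalCMJInvariants` (the class-number-one list, Silverman, *AEC*
App. C §11.3.1), recorded so that `hasEntireLFunction_of_j_eq_8000` is visibly an instance of the
tree's Deuring–Hecke leaf `hasEntireLFunction_of_j_mem_maximalCMJInvariants`.
[cite: SilvermanAEC2009, App. C §11 Ex. 11.3.1] -/
theorem eight_thousand_mem_maximalCMJInvariants : (8000 : ℚ) ∈ maximalCMJInvariants := by
  simp [maximalCMJInvariants]

/-- Consistency with the tree's Deuring–Hecke leaf: `hasEntireLFunction_of_j_mem_maximalCMJInvariants`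
(all nine CM `j`-invariants) implies the `j = 8000` statement proved here from Brewer's sum; i.e.
`hasEntireLFunction_of_j_eq_8000` discharges exactly the `j = 8000` row of that leaf.
[cite: SilvermanAdvancedTopics1994, II.10 Thm. 10.5] -/
theorem hasEntireLFunction_of_j_eq_8000_of_deuringHecke
    (hH : hasEntireLFunction_of_j_mem_maximalCMJInvariants)
    (W : WeierstrassCurve ℚ) [W.IsElliptic] (hj : W.j = 8000) : W.HasEntireLFunction :=
  hH W (hj ▸ eight_thousand_mem_maximalCMJInvariants)

end Literature.NumberTheory.EllipticCurves.SqrtTwoTwist
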